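import Summits.AtomisticToContinuum.Crystallization.Theorems.ExcessDecayLiouvilleCaccioppoliTail
import Summits.AtomisticToContinuum.Crystallization.Theorems.ExcessDecayLiouvilleGradientEstimateLocal

/-!
# Route `ExcessDecayLiouville`: the localised Caccioppoli inequality with an `ℓ²` tail — assembly

Second half of the tail form of the Caccioppoli bound for item `ExcessDecay` (stmt-AtomisticToContinuum-9334),
harmonic-replacement architecture (see `ExcessDecayLiouvilleCaccioppoliTail.lean` for the termwise majorant):

* `abs_cutoffForm_le_tail` :
  `|½ Σ'Σ' [p≠q] (η_p − η_q)² ⟪K(p−q) h_p, h_q⟫| ≤ (19·C₆/ρ²) M(R+ρ) + 19·F₈(ρ)·M(R) + 19·TT(h; c, R, ρ)`;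
* `caccioppoli_l2_tail` : `κ·nnForm(η•h) ≤ Σ' η² ⟪(Lh)(p), h p⟫ + (the same right-hand side)`;
* `gradient_estimate_tail_of_cutoff_of_dom` : `κ Σ_{x∈F} ‖h x − h (x + Aτ)‖² ≤ M_τ · (the same)` for a lattice period
  `τ` along which squared differences are dominated by `M_τ · nnForm` (`M_τ = 1` for `u₁, u₂`, `4` for `w₃`).

Here `M(r) = Σ'_p ‖h p‖² 𝟙[dist p c ≤ r]`, `TT(h; c, R, ρ) = Σ'_p Σ'_q [p≠q][ρ<|p−q|] |p−q|⁻⁸ 𝟙[dist p c ≤ R] ‖h q‖²`,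
`C₆ = 1024/(23/25)⁶`, `F₈(ρ) = 1024/((23/25)³ρ⁵)`.  All `[folklore]`; helper lemmas, nothing here closes an item.
-/

noncomputable section

namespace Summit.AtomisticToContinuum.Crystallization.Theorems.ExcessDecayLiouville

open scoped BigOperators Topology InnerProductSpace RealInnerProductSpace Classical
open Literature.MathematicalPhysics.StatisticalMechanics
open Summit.AtomisticToContinuum.Crystallization.Theorems.PhononStabilityNegative

-- Local notation: the force-constant map `K(e)w = h(|e|²)w + 2⟪e,w⟫h′(|e|²)e`.
local notation3 "𝕂[" e "] " w:max =>
  (-((‖e‖ ^ 2)⁻¹) ^ 7 + ((‖e‖ ^ 2)⁻¹) ^ 4) • w + (2 * ⟪e, w⟫ * (7 * ((‖e‖ ^ 2)⁻¹) ^ 8 - 4 * ((‖e‖ ^ 2)⁻¹) ^ 5)) • e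
-- indicator of a closed ball and the far inverse-power weight
set_option quotPrecheck false in
local notation "𝟙ᵇ[" x ", " c ", " R "]" => (if dist (x : EuclideanSpace ℝ (Fin 3)) c ≤ R then (1 : ℝ) else 0)
set_option quotPrecheck false in
local notation "𝔣[" ρ ", " p ", " q "]" =>
  (if ρ < dist (p : EuclideanSpace ℝ (Fin 3)) q then (dist (p : EuclideanSpace ℝ (Fin 3)) q)⁻¹ ^ 8 else (0 : ℝ))

section

variable {t : Fin 2 → (EuclideanSpace ℝ (Fin 3))} {A : (EuclideanSpace ℝ (Fin 3)) →L[ℝ] (EuclideanSpace ℝ (Fin 3))}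

set_option quotPrecheck false in
-- Local notation: the operator row `(L v)(p)`.
local notation "𝕃" v:max " @ " p:max =>
  tsum (fun q : Sites₀ t A => (if ((p : Sites₀ t A) : EuclideanSpace ℝ (Fin 3)) ≠ q then
    𝕂[((p : Sites₀ t A) : EuclideanSpace ℝ (Fin 3)) - q] (v ((p : Sites₀ t A) : EuclideanSpace ℝ (Fin 3)) - v q) else 0))

variable {h : (EuclideanSpace ℝ (Fin 3)) → (EuclideanSpace ℝ (Fin 3))} {η : (EuclideanSpace ℝ (Fin 3)) → ℝ}
  {c : (EuclideanSpace ℝ (Fin 3))} {R ρ : ℝ}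

set_option quotPrecheck false in
-- near family, the two far families, and the full majorant (all depending on the section variables `h c R ρ`)
local notation "𝐍[" p ", " q "]" =>
  (if ((p : Sites₀ t A) : (EuclideanSpace ℝ (Fin 3))) ≠ ((q : Sites₀ t A) : EuclideanSpace ℝ (Fin 3)) then
    (dist ((p : Sites₀ t A) : (EuclideanSpace ℝ (Fin 3))) q)⁻¹ ^ 6 * (‖h q‖ ^ 2 * 𝟙ᵇ[q, c, R + ρ]) else 0)
set_option quotPrecheck false in
local notation "𝐅𝐦[" p ", " q "]" =>
  (if ((p : Sites₀ t A) : (EuclideanSpace ℝ (Fin 3))) ≠ ((q : Sites₀ t A) : EuclideanSpace ℝ (Fin 3)) then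
    𝔣[ρ, p, q] * 𝟙ᵇ[p, c, R] * ‖h p‖ ^ 2 else 0)
set_option quotPrecheck false in
local notation "𝐅𝐭[" p ", " q "]" =>
  (if ((p : Sites₀ t A) : (EuclideanSpace ℝ (Fin 3))) ≠ ((q : Sites₀ t A) : EuclideanSpace ℝ (Fin 3)) then
    𝔣[ρ, p, q] * 𝟙ᵇ[p, c, R] * ‖h q‖ ^ 2 else 0)
set_option quotPrecheck false in
local notation "𝐗[" p ", " q "]" =>
  (if ((p : Sites₀ t A) : (EuclideanSpace ℝ (Fin 3))) ≠ ((q : Sites₀ t A) : EuclideanSpace ℝ (Fin 3)) then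
    (η p - η q) ^ 2 * ⟪𝕂[((p : Sites₀ t A) : (EuclideanSpace ℝ (Fin 3))) - q] (h p), h q⟫ else 0)

/-- **The Caccioppoli bound with an `ℓ²` tail** (see the module docstring). [folklore] -/
theorem abs_cutoffForm_le_tail (hA : Adm₀ A) (hI : Inner₀ t A)
    (hh : (Function.support h).Finite) {B : ℝ} (hB : ∀ x, ‖h x‖ ≤ B)
    (hη0 : ∀ x, 0 ≤ η x) (hη1 : ∀ x, η x ≤ 1)
    (hρ : 1 ≤ ρ)
    (hηR : ∀ p : Sites₀ t A, R < dist (p : (EuclideanSpace ℝ (Fin 3))) c → η p = 0)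
    (hlip : ∀ p q : Sites₀ t A, |η p - η q| ≤ ‖(p : (EuclideanSpace ℝ (Fin 3))) - q‖ / ρ) :
    |(1 / 2 : ℝ) * ∑' p : Sites₀ t A, ∑' q : Sites₀ t A, (if (p : (EuclideanSpace ℝ (Fin 3))) ≠ q then
        (η p - η q) ^ 2 * ⟪𝕂[(p : (EuclideanSpace ℝ (Fin 3))) - q] (h p), h q⟫ else 0)| ≤
      19 * (1024 / ((23 / 25 : ℝ) ^ 3 * (23 / 25 : ℝ) ^ 3)) / ρ ^ 2 * (∑' p : Sites₀ t A, ‖h p‖ ^ 2 * 𝟙ᵇ[p, c, R + ρ]) +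
      19 * (1024 / ((23 / 25 : ℝ) ^ 3 * ρ ^ 5)) * (∑' p : Sites₀ t A, ‖h p‖ ^ 2 * 𝟙ᵇ[p, c, R]) +
      19 * (∑' p : Sites₀ t A, ∑' q : Sites₀ t A, (if (p : (EuclideanSpace ℝ (Fin 3))) ≠ q then
        𝔣[ρ, p, q] * 𝟙ᵇ[p, c, R] * ‖h q‖ ^ 2 else 0)) := by
  classical
  have hB0 : 0 ≤ B := (norm_nonneg _).trans (hB 0)
  have hρ0 : 0 < ρ := by linarith
  have hρ' : (23 / 25 : ℝ) ≤ ρ := by linarith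
  -- the six weight families
  have hWn : Summable (Function.uncurry fun (p q : Sites₀ t A) => 𝐍[p, q]) := summable_nearWeight hA hI hh c R ρ
  have hWn' : Summable (Function.uncurry fun (p q : Sites₀ t A) => 𝐍[q, p]) := by
    refine hWn.prod_symm.congr fun pq => ?_
    obtain ⟨p, q⟩ := pq
    simp only [Prod.swap_prod_mk, Function.uncurry_apply_pair]
  have hWm : Summable (Function.uncurry fun (p q : Sites₀ t A) => 𝐅𝐦[p, q]) := summable_farMass hA hI hB c R hρ'
  have hWm' : Summable (Function.uncurry fun (p q : Sites₀ t A) => 𝐅𝐦[q, p]) := by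
    refine hWm.prod_symm.congr fun pq => ?_
    obtain ⟨p, q⟩ := pq
    simp only [Prod.swap_prod_mk, Function.uncurry_apply_pair]
  have hWt : Summable (Function.uncurry fun (p q : Sites₀ t A) => 𝐅𝐭[p, q]) := summable_farTail hA hI hB c R hρ'
  have hWt' : Summable (Function.uncurry fun (p q : Sites₀ t A) => 𝐅𝐭[q, p]) := by
    refine hWt.prod_symm.congr fun pq => ?_
    obtain ⟨p, q⟩ := pq
    simp only [Prod.swap_prod_mk, Function.uncurry_apply_pair]
  -- the majorant
  have hmaj : Summable (Function.uncurry fun (p q : Sites₀ t A) =>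
      19 / ρ ^ 2 * (𝐍[p, q] + 𝐍[q, p]) + 19 * (𝐅𝐦[p, q] + 𝐅𝐦[q, p] + 𝐅𝐭[p, q] + 𝐅𝐭[q, p])) := by
    have := ((hWn.add hWn').mul_left (19 / ρ ^ 2)).add ((((hWm.add hWm').add hWt).add hWt').mul_left 19)
    refine this.congr fun pq => ?_
    obtain ⟨p, q⟩ := pq
    simp only [Function.uncurry_apply_pair]
  have hterm : ∀ p q : Sites₀ t A, |𝐗[p, q]| ≤
      19 / ρ ^ 2 * (𝐍[p, q] + 𝐍[q, p]) + 19 * (𝐅𝐦[p, q] + 𝐅𝐦[q, p] + 𝐅𝐭[p, q] + 𝐅𝐭[q, p]) :=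
    fun p q => cutoffTerm_le_tail hA hI hη0 hη1 hρ hηR hlip p q
  have hXs : Summable (Function.uncurry fun (p q : Sites₀ t A) => 𝐗[p, q]) := by
    refine Summable.of_norm_bounded hmaj fun pq => ?_
    obtain ⟨p, q⟩ := pq
    rw [Real.norm_eq_abs]
    exact hterm p q
  -- ‖Σ'Σ' X‖ ≤ Σ'Σ' majorant
  have hrowle : ∀ p : Sites₀ t A, ‖∑' q : Sites₀ t A, 𝐗[p, q]‖ ≤
      ∑' q : Sites₀ t A, (19 / ρ ^ 2 * (𝐍[p, q] + 𝐍[q, p]) + 19 * (𝐅𝐦[p, q] + 𝐅𝐦[q, p] + 𝐅𝐭[p, q] + 𝐅𝐭[q, p])) := by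
    intro p
    have hr : Summable (fun q : Sites₀ t A => 𝐗[p, q]) := hXs.prod_factor p
    have hm : Summable (fun q : Sites₀ t A =>
        19 / ρ ^ 2 * (𝐍[p, q] + 𝐍[q, p]) + 19 * (𝐅𝐦[p, q] + 𝐅𝐦[q, p] + 𝐅𝐭[p, q] + 𝐅𝐭[q, p])) := hmaj.prod_factor p
    refine (norm_tsum_le_tsum_norm hr.norm).trans (hr.norm.tsum_le_tsum (fun q => ?_) hm)
    rw [Real.norm_eq_abs]
    exact hterm p q
  have hout : Summable (fun p : Sites₀ t A => ∑' q : Sites₀ t A, 𝐗[p, q]) := hXs.prod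
  have houtM : Summable (fun p : Sites₀ t A => ∑' q : Sites₀ t A,
      (19 / ρ ^ 2 * (𝐍[p, q] + 𝐍[q, p]) + 19 * (𝐅𝐦[p, q] + 𝐅𝐦[q, p] + 𝐅𝐭[p, q] + 𝐅𝐭[q, p]))) := hmaj.prod
  have h1 : ‖∑' p : Sites₀ t A, ∑' q : Sites₀ t A, 𝐗[p, q]‖ ≤
      ∑' p : Sites₀ t A, ∑' q : Sites₀ t A,
        (19 / ρ ^ 2 * (𝐍[p, q] + 𝐍[q, p]) + 19 * (𝐅𝐦[p, q] + 𝐅𝐦[q, p] + 𝐅𝐭[p, q] + 𝐅𝐭[q, p])) :=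
    (norm_tsum_le_tsum_norm hout.norm).trans (hout.norm.tsum_le_tsum hrowle houtM)
  -- split the majorant double sum into the six pieces
  have hrowM : ∀ p : Sites₀ t A, (∑' q : Sites₀ t A,
      (19 / ρ ^ 2 * (𝐍[p, q] + 𝐍[q, p]) + 19 * (𝐅𝐦[p, q] + 𝐅𝐦[q, p] + 𝐅𝐭[p, q] + 𝐅𝐭[q, p]))) =
      19 / ρ ^ 2 * ((∑' q : Sites₀ t A, 𝐍[p, q]) + ∑' q : Sites₀ t A, 𝐍[q, p]) +
      19 * ((∑' q : Sites₀ t A, 𝐅𝐦[p, q]) + (∑' q : Sites₀ t A, 𝐅𝐦[q, p]) + (∑' q : Sites₀ t A, 𝐅𝐭[p, q]) +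
        ∑' q : Sites₀ t A, 𝐅𝐭[q, p]) := by
    intro p
    have a1 : Summable (fun q : Sites₀ t A => 𝐍[p, q]) := hWn.prod_factor p
    have a2 : Summable (fun q : Sites₀ t A => 𝐍[q, p]) := hWn'.prod_factor p
    have a3 : Summable (fun q : Sites₀ t A => 𝐅𝐦[p, q]) := hWm.prod_factor p
    have a4 : Summable (fun q : Sites₀ t A => 𝐅𝐦[q, p]) := hWm'.prod_factor p
    have a5 : Summable (fun q : Sites₀ t A => 𝐅𝐭[p, q]) := hWt.prod_factor p
    have a6 : Summable (fun q : Sites₀ t A => 𝐅𝐭[q, p]) := hWt'.prod_factor p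
    have hs1 : Summable (fun q : Sites₀ t A => 19 / ρ ^ 2 * (𝐍[p, q] + 𝐍[q, p])) :=
      ((a1.add a2).mul_left (19 / ρ ^ 2)).congr fun q => rfl
    have hs2 : Summable (fun q : Sites₀ t A => 19 * (𝐅𝐦[p, q] + 𝐅𝐦[q, p] + 𝐅𝐭[p, q] + 𝐅𝐭[q, p])) :=
      ((((a3.add a4).add a5).add a6).mul_left 19).congr fun q => rfl
    rw [hs1.tsum_add hs2, tsum_mul_left, tsum_mul_left, a1.tsum_add a2, ((a3.add a4).add a5).tsum_add a6,
      (a3.add a4).tsum_add a5, a3.tsum_add a4]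
  have hMsum : (∑' p : Sites₀ t A, ∑' q : Sites₀ t A,
      (19 / ρ ^ 2 * (𝐍[p, q] + 𝐍[q, p]) + 19 * (𝐅𝐦[p, q] + 𝐅𝐦[q, p] + 𝐅𝐭[p, q] + 𝐅𝐭[q, p]))) =
      19 / ρ ^ 2 * ((∑' p : Sites₀ t A, ∑' q : Sites₀ t A, 𝐍[p, q]) + ∑' p : Sites₀ t A, ∑' q : Sites₀ t A, 𝐍[q, p]) +
      19 * ((∑' p : Sites₀ t A, ∑' q : Sites₀ t A, 𝐅𝐦[p, q]) + (∑' p : Sites₀ t A, ∑' q : Sites₀ t A, 𝐅𝐦[q, p]) +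
        (∑' p : Sites₀ t A, ∑' q : Sites₀ t A, 𝐅𝐭[p, q]) + ∑' p : Sites₀ t A, ∑' q : Sites₀ t A, 𝐅𝐭[q, p]) := by
    rw [tsum_congr hrowM]
    have b1 : Summable (fun p : Sites₀ t A => ∑' q : Sites₀ t A, 𝐍[p, q]) := hWn.prod
    have b2 : Summable (fun p : Sites₀ t A => ∑' q : Sites₀ t A, 𝐍[q, p]) := hWn'.prod
    have b3 : Summable (fun p : Sites₀ t A => ∑' q : Sites₀ t A, 𝐅𝐦[p, q]) := hWm.prod
    have b4 : Summable (fun p : Sites₀ t A => ∑' q : Sites₀ t A, 𝐅𝐦[q, p]) := hWm'.prod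
    have b5 : Summable (fun p : Sites₀ t A => ∑' q : Sites₀ t A, 𝐅𝐭[p, q]) := hWt.prod
    have b6 : Summable (fun p : Sites₀ t A => ∑' q : Sites₀ t A, 𝐅𝐭[q, p]) := hWt'.prod
    have hs1 : Summable (fun p : Sites₀ t A => 19 / ρ ^ 2 * ((∑' q : Sites₀ t A, 𝐍[p, q]) + ∑' q : Sites₀ t A, 𝐍[q, p])) :=
      ((b1.add b2).mul_left (19 / ρ ^ 2)).congr fun p => rfl
    have hs2 : Summable (fun p : Sites₀ t A => 19 * ((∑' q : Sites₀ t A, 𝐅𝐦[p, q]) + (∑' q : Sites₀ t A, 𝐅𝐦[q, p]) +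
        (∑' q : Sites₀ t A, 𝐅𝐭[p, q]) + ∑' q : Sites₀ t A, 𝐅𝐭[q, p])) :=
      ((((b3.add b4).add b5).add b6).mul_left 19).congr fun p => rfl
    rw [hs1.tsum_add hs2, tsum_mul_left, tsum_mul_left, b1.tsum_add b2, ((b3.add b4).add b5).tsum_add b6,
      (b3.add b4).tsum_add b5, b3.tsum_add b4]
  -- the six bounds
  have hA1 := tsum_tsum_nearWeight_le hA hI hh c R ρ
  have hA2 := tsum_tsum_nearWeight'_le hA hI hh c R ρ
  have hA3 := tsum_tsum_farMass_le hA hI hB c R hρ'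
  have hA4 := tsum_tsum_farMass'_le hA hI hB c R hρ'
  have hA6 := tsum_tsum_farTail'_eq hA hI hB c R hρ'
  -- conclude
  rw [abs_mul, abs_of_pos (by norm_num : (0 : ℝ) < 1 / 2), ← Real.norm_eq_abs]
  have h2 := h1.trans (le_of_eq hMsum)
  rw [hA6] at h2
  have hS0 : 0 ≤ ∑' p : Sites₀ t A, ‖h p‖ ^ 2 * 𝟙ᵇ[p, c, R + ρ] := tsum_nonneg fun p => by split_ifs <;> positivity
  have hS0' : 0 ≤ ∑' p : Sites₀ t A, ‖h p‖ ^ 2 * 𝟙ᵇ[p, c, R] := tsum_nonneg fun p => by split_ifs <;> positivity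
  have hT0 : 0 ≤ ∑' p : Sites₀ t A, ∑' q : Sites₀ t A, 𝐅𝐭[p, q] :=
    tsum_nonneg fun p => tsum_nonneg fun q => by split_ifs <;> positivity
  have hc1 : 0 ≤ 19 / ρ ^ 2 := by positivity
  -- (restate part (ii) with the bound variable of the other local masses, for `linarith`)
  have hA1' : (∑' p : Sites₀ t A, ∑' q : Sites₀ t A, 𝐍[p, q]) ≤
      (1024 / ((23 / 25 : ℝ) ^ 3 * (23 / 25 : ℝ) ^ 3)) * ∑' p : Sites₀ t A, ‖h p‖ ^ 2 * 𝟙ᵇ[p, c, R + ρ] := hA1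
  have e1 := mul_le_mul_of_nonneg_left (add_le_add hA1' hA2) hc1
  have hX0 := norm_nonneg (∑' p : Sites₀ t A, ∑' q : Sites₀ t A, 𝐗[p, q])
  have hkey : ‖∑' p : Sites₀ t A, ∑' q : Sites₀ t A, 𝐗[p, q]‖ ≤
      2 * (19 * (1024 / ((23 / 25 : ℝ) ^ 3 * (23 / 25 : ℝ) ^ 3)) / ρ ^ 2 * (∑' p : Sites₀ t A, ‖h p‖ ^ 2 * 𝟙ᵇ[p, c, R + ρ]) +
      19 * (1024 / ((23 / 25 : ℝ) ^ 3 * ρ ^ 5)) * (∑' p : Sites₀ t A, ‖h p‖ ^ 2 * 𝟙ᵇ[p, c, R]) +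
      19 * (∑' p : Sites₀ t A, ∑' q : Sites₀ t A, 𝐅𝐭[p, q])) := by
    refine h2.trans ?_
    have e1' : 19 / ρ ^ 2 * ((∑' p : Sites₀ t A, ∑' q : Sites₀ t A, 𝐍[p, q]) + ∑' p : Sites₀ t A, ∑' q : Sites₀ t A, 𝐍[q, p]) ≤
        2 * (19 * (1024 / ((23 / 25 : ℝ) ^ 3 * (23 / 25 : ℝ) ^ 3)) / ρ ^ 2 * (∑' p : Sites₀ t A, ‖h p‖ ^ 2 * 𝟙ᵇ[p, c, R + ρ])) := by
      refine e1.trans (le_of_eq ?_)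
      ring
    linarith [e1', hA3, hA4]
  linarith [hkey]

/-- **Caccioppoli inequality with an `ℓ²` tail**: `κ·nnForm(η•h) ≤ Σ' η² ⟪(Lh)(p), h p⟫ + (19·C₆/ρ²) M(R+ρ) +
19·F₈(ρ)·M(R) + 19·TT(h; c, R, ρ)`. [folklore] -/
theorem caccioppoli_l2_tail (hA : Adm₀ A) (hI : Inner₀ t A) {κ : ℝ}
    (hκ : ∀ v : (EuclideanSpace ℝ (Fin 3)) → (EuclideanSpace ℝ (Fin 3)), (Function.support v).Finite →
      Function.support v ⊆ Sites₀ t A → κ * nnForm t A v ≤ ∑' p : Sites₀ t A, ⟪𝕃 v @ p, v p⟫)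
    (hh : (Function.support h).Finite) {B : ℝ} (hB : ∀ x, ‖h x‖ ≤ B)
    (hη : (Function.support η).Finite) (hηS : Function.support η ⊆ Sites₀ t A)
    (hη0 : ∀ x, 0 ≤ η x) (hη1 : ∀ x, η x ≤ 1) (hρ : 1 ≤ ρ)
    (hηR : ∀ p : Sites₀ t A, R < dist (p : (EuclideanSpace ℝ (Fin 3))) c → η p = 0)
    (hlip : ∀ p q : Sites₀ t A, |η p - η q| ≤ ‖(p : (EuclideanSpace ℝ (Fin 3))) - q‖ / ρ) :
    κ * nnForm t A (fun x => η x • h x) ≤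
      (∑' p : Sites₀ t A, (η p) ^ 2 * ⟪𝕃 h @ p, h p⟫) +
      (19 * (1024 / ((23 / 25 : ℝ) ^ 3 * (23 / 25 : ℝ) ^ 3)) / ρ ^ 2 * (∑' p : Sites₀ t A, ‖h p‖ ^ 2 * 𝟙ᵇ[p, c, R + ρ]) +
      19 * (1024 / ((23 / 25 : ℝ) ^ 3 * ρ ^ 5)) * (∑' p : Sites₀ t A, ‖h p‖ ^ 2 * 𝟙ᵇ[p, c, R]) +
      19 * (∑' p : Sites₀ t A, ∑' q : Sites₀ t A, (if (p : (EuclideanSpace ℝ (Fin 3))) ≠ q then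
        𝔣[ρ, p, q] * 𝟙ᵇ[p, c, R] * ‖h q‖ ^ 2 else 0))) := by
  have h1 := caccioppoli_inhomogeneous hA hI hκ hB hη hηS
  have h2 := abs_cutoffForm_le_tail hA hI hh hB hη0 hη1 hρ hηR hlip
  linarith [h1, (le_abs_self _).trans h2]

/-- **Gradient estimate with an `ℓ²` tail, along an arbitrary lattice period** `τ ∈ Λ₀` along which squared
differences of finitely supported displacements are dominated by `M · nnForm` (hypothesis `hdom`; `M = 1` for the
nearest-neighbour translations `u₁, u₂` by `tsum_norm_sub_translate_sq_le_nnForm`, `M = 4` for the vertical period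
`w₃` by `tsum_norm_sub_vertical_sq_le_nnForm`): for a finite set `F` of sites at which and at whose translates the
cutoff equals `1`, `κ Σ_{x∈F} ‖h x − h (x + Aτ)‖²` is at most `M` times the right-hand side of `caccioppoli_l2_tail`.
[folklore] -/
theorem gradient_estimate_tail_of_cutoff_of_dom (hA : Adm₀ A) (hI : Inner₀ t A) {κ : ℝ} (hκ0 : 0 ≤ κ)
    (hκ : ∀ v : (EuclideanSpace ℝ (Fin 3)) → (EuclideanSpace ℝ (Fin 3)), (Function.support v).Finite →
      Function.support v ⊆ Sites₀ t A → κ * nnForm t A v ≤ ∑' p : Sites₀ t A, ⟪𝕃 v @ p, v p⟫)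
    (hh : (Function.support h).Finite) {B : ℝ} (hB : ∀ x, ‖h x‖ ≤ B)
    (hη : (Function.support η).Finite) (hηS : Function.support η ⊆ Sites₀ t A)
    (hη0 : ∀ x, 0 ≤ η x) (hη1 : ∀ x, η x ≤ 1) (hρ : 1 ≤ ρ)
    (hηR : ∀ p : Sites₀ t A, R < dist (p : (EuclideanSpace ℝ (Fin 3))) c → η p = 0)
    (hlip : ∀ p q : Sites₀ t A, |η p - η q| ≤ ‖(p : (EuclideanSpace ℝ (Fin 3))) - q‖ / ρ)
    {τ : (EuclideanSpace ℝ (Fin 3))} (hτ : τ ∈ Λ₀) {M : ℝ} (hM : 0 ≤ M)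
    (hdom : ∀ v : (EuclideanSpace ℝ (Fin 3)) → (EuclideanSpace ℝ (Fin 3)), (Function.support v).Finite →
      ∑' p : Sites₀ t A, ‖v p - v ((p : (EuclideanSpace ℝ (Fin 3))) + A τ)‖ ^ 2 ≤ M * nnForm t A v)
    (F : Finset (EuclideanSpace ℝ (Fin 3))) (hF : ∀ x ∈ F, x ∈ Sites₀ t A ∧ η x = 1 ∧ η (x + A τ) = 1) :
    κ * ∑ x ∈ F, ‖h x - h (x + A τ)‖ ^ 2 ≤
      M * ((∑' p : Sites₀ t A, (η p) ^ 2 * ⟪𝕃 h @ p, h p⟫) +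
      (19 * (1024 / ((23 / 25 : ℝ) ^ 3 * (23 / 25 : ℝ) ^ 3)) / ρ ^ 2 * (∑' p : Sites₀ t A, ‖h p‖ ^ 2 * 𝟙ᵇ[p, c, R + ρ]) +
      19 * (1024 / ((23 / 25 : ℝ) ^ 3 * ρ ^ 5)) * (∑' p : Sites₀ t A, ‖h p‖ ^ 2 * 𝟙ᵇ[p, c, R]) +
      19 * (∑' p : Sites₀ t A, ∑' q : Sites₀ t A, (if (p : (EuclideanSpace ℝ (Fin 3))) ≠ q then
        𝔣[ρ, p, q] * 𝟙ᵇ[p, c, R] * ‖h q‖ ^ 2 else 0)))) := by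
  classical
  have hC := caccioppoli_l2_tail hA hI hκ hh hB hη hηS hη0 hη1 hρ hηR hlip
  have ha : (Function.support fun x : (EuclideanSpace ℝ (Fin 3)) => η x • h x).Finite :=
    hη.subset fun x hx => by
      simp only [Function.mem_support, ne_eq, smul_eq_zero, not_or] at hx ⊢
      exact hx.1
  have hD := hdom _ ha
  have hsum : Summable (fun p : Sites₀ t A =>
      ‖η p • h p - η ((p : (EuclideanSpace ℝ (Fin 3))) + A τ) • h ((p : (EuclideanSpace ℝ (Fin 3))) + A τ)‖ ^ 2) :=
    summable_norm_sub_translate_sq (t := t) (A := A) ha hτ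
  set G : Finset (Sites₀ t A) := F.attach.image (fun x => ⟨x.1, (hF x.1 x.2).1⟩) with hG
  have hinj : Set.InjOn (fun x : {x // x ∈ F} => (⟨x.1, (hF x.1 x.2).1⟩ : Sites₀ t A))
      (F.attach : Set {x // x ∈ F}) := by
    intro a _ b _ hab
    have : (a : (EuclideanSpace ℝ (Fin 3))) = b := congrArg (fun s : Sites₀ t A => (s : (EuclideanSpace ℝ (Fin 3)))) hab
    exact Subtype.ext this
  have hpart : ∑ x ∈ F, ‖h x - h (x + A τ)‖ ^ 2 ≤
      ∑' p : Sites₀ t A, ‖η p • h p - η ((p : (EuclideanSpace ℝ (Fin 3))) + A τ) • h ((p : (EuclideanSpace ℝ (Fin 3))) + A τ)‖ ^ 2 := by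
    have h1 : ∑ x ∈ F, ‖h x - h (x + A τ)‖ ^ 2 =
        ∑ p ∈ G, ‖η p • h p - η ((p : (EuclideanSpace ℝ (Fin 3))) + A τ) • h ((p : (EuclideanSpace ℝ (Fin 3))) + A τ)‖ ^ 2 := by
      rw [hG, Finset.sum_image hinj, ← Finset.sum_attach F]
      refine Finset.sum_congr rfl fun x _ => ?_
      obtain ⟨-, hx1, hx2⟩ := hF x.1 x.2
      simp only [hx1, hx2, one_smul]
    rw [h1]
    exact hsum.sum_le_tsum G (fun p _ => sq_nonneg _)
  calc κ * ∑ x ∈ F, ‖h x - h (x + A τ)‖ ^ 2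
      ≤ κ * ∑' p : Sites₀ t A, ‖η p • h p - η ((p : (EuclideanSpace ℝ (Fin 3))) + A τ) • h ((p : (EuclideanSpace ℝ (Fin 3))) + A τ)‖ ^ 2 :=
        mul_le_mul_of_nonneg_left hpart hκ0
    _ ≤ κ * (M * nnForm t A (fun x => η x • h x)) := mul_le_mul_of_nonneg_left hD hκ0
    _ = M * (κ * nnForm t A (fun x => η x • h x)) := by ring
    _ ≤ _ := mul_le_mul_of_nonneg_left hC hM

end

end Summit.AtomisticToContinuum.Crystallization.Theorems.ExcessDecayLiouville

end
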